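import Mathlib
import HarnessLib
import Summits.HubbardSuperconductivity.HubbardSuperconductivity.Theorems.KLProgrammeKLRegimeFlowReadScaleZeroDoors

/-!
# Route `KLProgramme`, crux K3 — gen-8 ENGINE-FLOW child (stmt-HubbardSuperconductivity-20437 `KLRegimeEngineV17F2`), stub (C)
# `stub_twoLeg_curvature` at `n = 0`: «(C)-SCALE0-MIXED» — the ROUTE-AGNOSTIC receiving door for located item #22: the scale-`0` grid element
# SPLIT `W₀ = W_a + W_b`, with `W_a` entering through position-space MOMENTS (Bell tables at certified curve sizes) and `W_b` entering through
# ON-CURVE data of its own interpolated symbol (value, structured value, angular jets on the free Fermi curve)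

Seat hubbard-kl-k3c3-p1 (g13; row «δμ-flow with klAngularMean constant piece»).  Why (memo C-BASE-TOLERANCE.md, evidence #60; k3c5-p1 SCALE0-PT2-SIZING v1 §3/§6):
no position-space moment door carries the rows `k = 3, 4` of (C) at `n = 0` (the UV sunset kernel decays like `r^{−9/2}` out to the cutoff length), so those
rows — and every `e(k⃗)`-function piece such as the Hartree chain, which is θ-constant on the free curve up to `I_L`-aliasing — must be supplied as bounds ON
THE CURVE, while the value/Osc/low rows come cheapest from moments.  This file lets a supplier choose the route PER PIECE:

* §1 the momentum symbol `loc(X)(k⃗) = ¼Σ_σ[Re Σ_X((ω₀,k⃗),σ) + Re Σ_X((−ω₀,k⃗),σ)]` of a Hubbard Grassmann element is ADDITIVE in `X`, and so is its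
  interpolant read at a continuum momentum (`locSymbol_add`, `evalM_symInterp_locSymbol_add`);
* §2 for ANY grid element `W` (any pinning `x, τ`): momentum sup-jets of `evalM (symInterp L (loc (map S W)))` from the pinned kernel sums of `W`
  (`gridSymbol_norm_le_of_pinned`, `gridSymbol_jet_le_of_offSite`) and the structured value `|… − loc_c(0)| ≤ (2|P|/(|β|L²))·B_off` (`gridSymbol_structuredValue_of_offSite`)
  — p1b's bridge and this seat's p600439 §2, stated for a PART of `W₀` rather than for `W₀`;
* §3 **`twoLegRead_frameZero_of_split_certD`**: `W₀ := effAction (S_{4M}ᵀ C⁰_{>e₀} S_{4M}) V_{4M} = W_a + W_b`; `W_a`: on-site value sum `≤ v|U|·β/4M`, off-site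
  moments `≤ b_k·U²·β/4M` (`k ≤ 4`); free curve `γ₀ ∈ C⁴`, `‖γ₀^{(i)}‖ ≤ D i`; `W_b`: with `H := evalM (symInterp L (loc (map S W_b)))`, `|H(γ₀θ)| ≤ hv|U| + h₀U²`,
  `|H(γ₀θ) − τ| ≤ s₀U²`, `|∂θᵏ(H∘γ₀)| ≤ s_k U²` (`1 ≤ k ≤ 4`) ⟹ `TwoLegReadJetBound L M cMix cMix′ β U μ (K₀) 0 ∧ TwoLegReadOscAt L M (4b₀ + 2s₀) β U μ (K₀) 0`,
  `cMix = (2v + hv, Bell₁(2b,D) + s₁, …, Bell₄(2b,D) + s₄)`, `cMix′ = (2b₀ + h₀, 0, …)`; plus the `hAval` form for `twoLegReadPriv_zero` (`a := 2b₀ + s₀`);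
* §4 **`twoLegRead_frameZero_registered_of_split_certD`**: five fits against `klC4aJetC2 / klC4aJetC′ P R / klReadOscC P R` ⟹ the REGISTERED n = 0 conclusion of (C).

Only `klBetaMin ≤ β` is used (no regime binder).  Proofs only; no definitions; the inputs are HYPOTHESES (item #22) — nothing here asserts any stub of
20437, K3 or superconductivity.  References: BGM 2006 §2.4 (2.36), §3 (3.2)–(3.3) [cite: BenfattoGiulianiMastropietro2006]; FST II [cite: FeldmanSalmhoferTrubowitz1998].
-/

noncomputable section

namespace Summit.HubbardSuperconductivity.HubbardSuperconductivity.Theorems.KLRegimeSplit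

set_option linter.dupNamespace false -- summit = problem name (single-conjunct summit), D-0017

open Real Finset Literature.MathematicalPhysics.QuantumLattice Literature.Probability.LatticeModels GrassmannAlgebra
open Literature.MathematicalPhysics.QuantumLattice.FermiRG Literature.Probability.LatticeModels.BattleFederbush
open Summit.HubbardSuperconductivity.HubbardSuperconductivity.Theorems.KLProgrammeLegKernels
open Summit.HubbardSuperconductivity.HubbardSuperconductivity.Theorems.TwoLegFourier
open Summit.HubbardSuperconductivity.HubbardSuperconductivity.Theorems.EngineV8
open Summit.HubbardSuperconductivity.HubbardSuperconductivity.Theorems.PerturbedFermiCurve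
open Summit.HubbardSuperconductivity.HubbardSuperconductivity.Theorems.DispersionFlow

/-! ## §1 Additivity of the momentum symbol of a Grassmann element -/

section Symbol

variable {L M : ℕ} [NeZero L] [NeZero M]

omit [NeZero L] in
/-- **The localised two-leg symbol is additive in the Grassmann element**: `loc(X + Y) = loc(X) + loc(Y)` pointwise on the torus momenta. -/
theorem locSymbol_add (β : ℝ) (X Y : HubbardGrassmann L M) :
    (fun k : TorusSite 2 L => (∑ σ : Fin 2, ((selfEnergy L M β (X + Y) (omega0 M, k) σ).re +
        (selfEnergy L M β (X + Y) ((omega0 M).rev, k) σ).re)) / 4) =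
      (fun k => (∑ σ : Fin 2, ((selfEnergy L M β X (omega0 M, k) σ).re + (selfEnergy L M β X ((omega0 M).rev, k) σ).re)) / 4) +
        fun k => (∑ σ : Fin 2, ((selfEnergy L M β Y (omega0 M, k) σ).re + (selfEnergy L M β Y ((omega0 M).rev, k) σ).re)) / 4 := by
  funext k
  have hadd : ∀ (K : FreqMomentum L M) (σ : Fin 2),
      selfEnergy L M β (X + Y) K σ = selfEnergy L M β X K σ + selfEnergy L M β Y K σ := fun K σ => by
    simp only [selfEnergy, vertexFn_def, kernel_add, mul_add]
  simp only [Pi.add_apply, hadd, Complex.add_re, Fin.sum_univ_two]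
  ring

/-- **The interpolant of a sum is the sum of the interpolants** (function form of `evalM_symInterp_add`). -/
theorem evalM_symInterp_add_fun (f g : TorusSite 2 L → ℝ) :
    evalM (symInterp L (f + g)) = evalM (symInterp L f) + evalM (symInterp L g) := by
  show evalM (symInterp L (fun k => f k + g k)) = _
  rw [evalM_symInterp_add L f g]
  rfl

/-- **`loc` of the interpolant is additive**: `evalM (symInterp L (loc (X + Y))) = evalM (symInterp L (loc X)) + evalM (symInterp L (loc Y))`. -/
theorem evalM_symInterp_locSymbol_add (β : ℝ) (X Y : HubbardGrassmann L M) :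
    evalM (symInterp L (fun k : TorusSite 2 L => (∑ σ : Fin 2, ((selfEnergy L M β (X + Y) (omega0 M, k) σ).re +
        (selfEnergy L M β (X + Y) ((omega0 M).rev, k) σ).re)) / 4)) =
      evalM (symInterp L (fun k => (∑ σ : Fin 2, ((selfEnergy L M β X (omega0 M, k) σ).re +
          (selfEnergy L M β X ((omega0 M).rev, k) σ).re)) / 4)) +
        evalM (symInterp L (fun k => (∑ σ : Fin 2, ((selfEnergy L M β Y (omega0 M, k) σ).re +
          (selfEnergy L M β Y ((omega0 M).rev, k) σ).re)) / 4)) := by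
  rw [locSymbol_add β X Y, evalM_symInterp_add_fun]

end Symbol

/-! ## §2 A PART of the scale-0 grid element: momentum sizes and structured value from its own pinned sums -/

section Grid

variable {L M : ℕ} [NeZero L] [NeZero M] {P : Type*} [Fintype P] [DecidableEq P]

/-- **Value size of a grid element's interpolated symbol from the FULL pinned sum**: `‖evalM (symInterp L (loc (map S W))) q‖ ≤ (2|P|/(|β|L²))·B`. -/
theorem gridSymbol_norm_le_of_pinned {β : ℝ} (hβ : β ≠ 0) (x : P → TorusSite 2 L) (τ : P → ℝ) (W : GrassmannAlgebra ℂ (GridLeg P)) {B : ℝ}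
    (hB0 : ∀ (σ : Fin 2) (p₀ : P), ∑ p₁ : P, ‖kernel ℂ W 2 (fun i => ((![p₀, p₁] i, σ), i))‖ ≤ B) (q : Momentum) :
    ‖iteratedFDeriv ℝ 0 (evalM (symInterp L (fun k : TorusSite 2 L =>
        (∑ σ : Fin 2, ((selfEnergy L M β (ExteriorAlgebra.map (Matrix.toLin' (gridSubMatrix L M β x τ)) W) (omega0 M, k) σ).re +
          (selfEnergy L M β (ExteriorAlgebra.map (Matrix.toLin' (gridSubMatrix L M β x τ)) W) ((omega0 M).rev, k) σ).re)) / 4))) q‖ ≤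
      2 * (Fintype.card P : ℝ) / (|β| * (L : ℝ) ^ 2) * B := by
  refine (norm_iteratedFDeriv_zero_evalM_symInterp_le L _ q).trans ?_
  have h := sum_evenWeight_abs_torusCosCoeff_locRe_map_gridSub_le (L := L) (M := M) hβ x τ W (w := fun _ => (1 : ℝ))
    (fun _ => zero_le_one) (fun _ => rfl) (B := B) (fun σ p₀ => by simpa only [one_mul] using hB0 σ p₀)
  simpa only [one_mul] using h

/-- **Momentum sup-jet of order `k ≥ 1` of a grid element's interpolated symbol from the OFF-SITE weighted pinned sum** (weight
`[x⃗ p₁ ≠ x⃗ p₀]·(1+|Δx̃₀|+|Δx̃₁|)ᵏ`): `‖Dᵏ evalM (symInterp L (loc (map S W))) q‖ ≤ (2|P|/(|β|L²))·B`. -/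
theorem gridSymbol_jet_le_of_offSite {β : ℝ} (hβ : β ≠ 0) (x : P → TorusSite 2 L) (τ : P → ℝ) (W : GrassmannAlgebra ℂ (GridLeg P)) {k : ℕ}
    (hk : 1 ≤ k) {B : ℝ}
    (hBk : ∀ (σ : Fin 2) (p₀ : P), ∑ p₁ : P,
      (if x p₁ - x p₀ = 0 then (0 : ℝ) else
        (1 + (((x p₁ - x p₀) 0).valMinAbs.natAbs : ℝ) + (((x p₁ - x p₀) 1).valMinAbs.natAbs : ℝ)) ^ k) *
        ‖kernel ℂ W 2 (fun i => ((![p₀, p₁] i, σ), i))‖ ≤ B) (q : Momentum) :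
    ‖iteratedFDeriv ℝ k (evalM (symInterp L (fun p : TorusSite 2 L =>
        (∑ σ : Fin 2, ((selfEnergy L M β (ExteriorAlgebra.map (Matrix.toLin' (gridSubMatrix L M β x τ)) W) (omega0 M, p) σ).re +
          (selfEnergy L M β (ExteriorAlgebra.map (Matrix.toLin' (gridSubMatrix L M β x τ)) W) ((omega0 M).rev, p) σ).re)) / 4))) q‖ ≤
      2 * (Fintype.card P : ℝ) / (|β| * (L : ℝ) ^ 2) * B := by
  refine (norm_iteratedFDeriv_evalM_symInterp_le_offZero_moments L _ hk q).trans ?_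
  set w : TorusSite 2 L → ℝ := fun z =>
    if z = 0 then (0 : ℝ) else (1 + ((z 0).valMinAbs.natAbs : ℝ) + ((z 1).valMinAbs.natAbs : ℝ)) ^ k with hw
  have hw0 : ∀ z, 0 ≤ w z := fun z => by rw [hw]; dsimp only; split_ifs <;> positivity
  have hweven : ∀ z, w (-z) = w z := fun z => by simp only [hw]; exact offDiagWeight_neg k z
  have h := sum_evenWeight_abs_torusCosCoeff_locRe_map_gridSub_le (L := L) (M := M) hβ x τ W hw0 hweven (B := B)
    (fun σ p₀ => hBk σ p₀)
  refine le_trans (le_of_eq ?_) h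
  rw [sum_filter]
  refine sum_congr rfl fun y _ => ?_
  simp only [hw]
  by_cases hy : y = 0
  · rw [if_neg (not_not.2 hy), if_pos hy, zero_mul]
  · rw [if_pos hy, if_neg hy]

/-- **Structured value of a grid element's interpolated symbol from the OFF-SITE pinned VALUE sum** (weight `[x⃗ p₁ ≠ x⃗ p₀]`):
`|evalM (symInterp L (loc (map S W))) q − loc_c(0)| ≤ (2|P|/(|β|L²))·B` at every continuum momentum — the on-site part of `W` is in the θ-free constant. -/
theorem gridSymbol_structuredValue_of_offSite {β : ℝ} (hβ : β ≠ 0) (x : P → TorusSite 2 L) (τ : P → ℝ) (W : GrassmannAlgebra ℂ (GridLeg P)) {B : ℝ}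
    (hBoff : ∀ (σ : Fin 2) (p₀ : P), ∑ p₁ : P,
      (if x p₁ - x p₀ = 0 then (0 : ℝ) else 1) * ‖kernel ℂ W 2 (fun i => ((![p₀, p₁] i, σ), i))‖ ≤ B) (q : Momentum) :
    |evalM (symInterp L (fun p : TorusSite 2 L =>
        (∑ σ : Fin 2, ((selfEnergy L M β (ExteriorAlgebra.map (Matrix.toLin' (gridSubMatrix L M β x τ)) W) (omega0 M, p) σ).re +
          (selfEnergy L M β (ExteriorAlgebra.map (Matrix.toLin' (gridSubMatrix L M β x τ)) W) ((omega0 M).rev, p) σ).re)) / 4)) q -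
      torusCosCoeff L (fun p : TorusSite 2 L =>
        (∑ σ : Fin 2, ((selfEnergy L M β (ExteriorAlgebra.map (Matrix.toLin' (gridSubMatrix L M β x τ)) W) (omega0 M, p) σ).re +
          (selfEnergy L M β (ExteriorAlgebra.map (Matrix.toLin' (gridSubMatrix L M β x τ)) W) ((omega0 M).rev, p) σ).re)) / 4) 0| ≤
      2 * (Fintype.card P : ℝ) / (|β| * (L : ℝ) ^ 2) * B := by
  refine (abs_evalM_symInterp_sub_torusCosCoeff_zero_le L _ q).trans ?_
  rw [sum_filter_ne_zero_abs_torusCosCoeff_eq]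
  exact sum_evenWeight_abs_torusCosCoeff_locRe_map_gridSub_le (L := L) (M := M) hβ x τ W (w := fun z => if z = 0 then (0 : ℝ) else 1)
    (fun z => by split_ifs <;> norm_num) (fun z => by simp only [neg_eq_zero]) hBoff

end Grid

/-! ## §3 The mixed door at the bare frame -/

section Door

variable {L M : ℕ} [NeZero L] [NeZero M] {R : RenConsts} {μ U β : ℝ}

/-- **(C) AT `n = 0` FROM A SPLIT GRID ELEMENT — MOMENT PART + ON-CURVE PART, CERTIFIED CURVE SIZES, PRIVATE TABLES.**
Let `W₀ := effAction (S_{4M}ᵀ C⁰_{>e₀} S_{4M}) V_{4M} = W_a + W_b` (grid Grassmann elements), `S := S_{4M}` the grid substitution,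
`H := evalM (symInterp L (loc (map S W_b)))` the interpolated symbol of the second part, `γ₀ := toLp ∘ klFermiPoint μ 0` the free Fermi-point map.  If
* (a-on) `Σ_{p₁}[x⃗₁ = x⃗₀]‖kernel₂ W_a‖ ≤ v|U|·β/4M` and (a-off) `Σ_{p₁}[x⃗₁ ≠ x⃗₀](1+|Δx̃₀|+|Δx̃₁|)ᵏ‖kernel₂ W_a‖ ≤ b_k·U²·β/4M` (`k ≤ 4`),
* (curve) `γ₀ ∈ C⁴`, `‖γ₀^{(i)}(θ)‖ ≤ D i` (`1 ≤ i ≤ 4`),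
* (b-val) `|H(γ₀ θ)| ≤ hv·|U| + h₀·U²`, (b-τ) `|H(γ₀ θ) − τ| ≤ s 0·U²`, (b-jet) `|∂θᵏ (H ∘ γ₀)(θ)| ≤ s k·U²` (`1 ≤ k ≤ 4`),
then `TwoLegReadJetBound L M cMix cMix′ β U μ (K₀) 0 ∧ TwoLegReadOscAt L M (4·b 0 + 2·s 0) β U μ (K₀) 0` with
`cMix = (2v + hv, 2b₁D₁ + s₁, 2b₂D₁² + 2b₁D₂ + s₂, 2b₃D₁³ + 6b₂D₁D₂ + 2b₁D₃ + s₃, 2b₄D₁⁴ + 12b₃D₁²D₂ + 6b₂D₂² + 8b₂D₁D₃ + 2b₁D₄ + s₄, 0, …)`,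
`cMix′ = (2b₀ + h₀, 0, …)`.  Route-agnostic: the Hartree chain (θ-constant on the free curve up to `I_L`-aliasing) and the sunset's rows 3–4 (on-curve
supplier) go into `W_b`, the rest into `W_a`. -/
theorem twoLegRead_frameZero_of_split_certD (hβ : klBetaMin ≤ β) {v hv h0 τ : ℝ} {b D s : ℕ → ℝ}
    (Wa Wb : GrassmannAlgebra ℂ (GridLeg (GridPoint L (2 * (2 * M)))))
    (hsplit : effAction ℂ ((hubbardGridSub L M β (2 * (2 * M))).transpose * hubbardCovAboveCT L M β μ 0 0 klE0 *
        hubbardGridSub L M β (2 * (2 * M))) (hubbardGridInteraction L (2 * (2 * M)) β U) = Wa + Wb)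
    (hBon : ∀ (σ : Fin 2) (p₀ : GridPoint L (2 * (2 * M))), ∑ p₁ : GridPoint L (2 * (2 * M)),
      (if p₁.2 - p₀.2 = 0 then (1 : ℝ) else 0) * ‖kernel ℂ Wa 2 (fun i => ((![p₀, p₁] i, σ), i))‖ ≤ v * |U| * (β / ((2 * (2 * M) : ℕ) : ℝ)))
    (hBoff : ∀ k ≤ 4, ∀ (σ : Fin 2) (p₀ : GridPoint L (2 * (2 * M))), ∑ p₁ : GridPoint L (2 * (2 * M)),
      (if p₁.2 - p₀.2 = 0 then (0 : ℝ) else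
        (1 + (((p₁.2 - p₀.2) 0).valMinAbs.natAbs : ℝ) + (((p₁.2 - p₀.2) 1).valMinAbs.natAbs : ℝ)) ^ k) *
        ‖kernel ℂ Wa 2 (fun i => ((![p₀, p₁] i, σ), i))‖ ≤ b k * U ^ 2 * (β / ((2 * (2 * M) : ℕ) : ℝ)))
    (hγ : ContDiff ℝ 4 fun θ : ℝ => (WithLp.toLp 2 (klFermiPoint μ 0 θ) : Momentum))
    (hD : ∀ θ : ℝ, ∀ i, 1 ≤ i → i ≤ 4 → ‖iteratedDeriv i (fun θ : ℝ => (WithLp.toLp 2 (klFermiPoint μ 0 θ) : Momentum)) θ‖ ≤ D i)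
    (hHval : ∀ θ : ℝ, |evalM (symInterp L (fun p : TorusSite 2 L =>
        (∑ σ : Fin 2, ((selfEnergy L M β (ExteriorAlgebra.map (Matrix.toLin' (gridSubMatrix L M β
            (fun p : GridPoint L (2 * (2 * M)) => p.2) (fun p => gridTime β (2 * (2 * M)) p.1))) Wb) (omega0 M, p) σ).re +
          (selfEnergy L M β (ExteriorAlgebra.map (Matrix.toLin' (gridSubMatrix L M β
            (fun p : GridPoint L (2 * (2 * M)) => p.2) (fun p => gridTime β (2 * (2 * M)) p.1))) Wb) ((omega0 M).rev, p) σ).re)) / 4))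
        (WithLp.toLp 2 (klFermiPoint μ 0 θ))| ≤ hv * |U| + h0 * U ^ 2)
    (hHτ : ∀ θ : ℝ, |evalM (symInterp L (fun p : TorusSite 2 L =>
        (∑ σ : Fin 2, ((selfEnergy L M β (ExteriorAlgebra.map (Matrix.toLin' (gridSubMatrix L M β
            (fun p : GridPoint L (2 * (2 * M)) => p.2) (fun p => gridTime β (2 * (2 * M)) p.1))) Wb) (omega0 M, p) σ).re +
          (selfEnergy L M β (ExteriorAlgebra.map (Matrix.toLin' (gridSubMatrix L M β
            (fun p : GridPoint L (2 * (2 * M)) => p.2) (fun p => gridTime β (2 * (2 * M)) p.1))) Wb) ((omega0 M).rev, p) σ).re)) / 4))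
        (WithLp.toLp 2 (klFermiPoint μ 0 θ)) - τ| ≤ s 0 * U ^ 2)
    (hHjet : ∀ k, 1 ≤ k → k ≤ 4 → ∀ θ : ℝ, |iteratedDeriv k (fun θ : ℝ => evalM (symInterp L (fun p : TorusSite 2 L =>
        (∑ σ : Fin 2, ((selfEnergy L M β (ExteriorAlgebra.map (Matrix.toLin' (gridSubMatrix L M β
            (fun p : GridPoint L (2 * (2 * M)) => p.2) (fun p => gridTime β (2 * (2 * M)) p.1))) Wb) (omega0 M, p) σ).re +
          (selfEnergy L M β (ExteriorAlgebra.map (Matrix.toLin' (gridSubMatrix L M β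
            (fun p : GridPoint L (2 * (2 * M)) => p.2) (fun p => gridTime β (2 * (2 * M)) p.1))) Wb) ((omega0 M).rev, p) σ).re)) / 4))
        (WithLp.toLp 2 (klFermiPoint μ 0 θ))) θ| ≤ s k * U ^ 2) :
    TwoLegReadJetBound L M
        (fun k => if k = 0 then 2 * v + hv else if k = 1 then 2 * b 1 * D 1 + s 1 else if k = 2 then 2 * b 2 * D 1 ^ 2 + 2 * b 1 * D 2 + s 2
          else if k = 3 then 2 * b 3 * D 1 ^ 3 + 3 * (2 * b 2) * D 1 * D 2 + 2 * b 1 * D 3 + s 3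
          else if k = 4 then 2 * b 4 * D 1 ^ 4 + 6 * (2 * b 3) * D 1 ^ 2 * D 2 + 3 * (2 * b 2) * D 2 ^ 2 + 4 * (2 * b 2) * D 1 * D 3 + 2 * b 1 * D 4 + s 4
          else 0)
        (fun k => if k = 0 then 2 * b 0 + h0 else 0) β U μ (klFlowFrameU L M β U μ 0) 0 ∧
      TwoLegReadOscAt L M (4 * b 0 + 2 * s 0) β U μ (klFlowFrameU L M β U μ 0) 0 := by
  have hβ0 : 0 < β := lt_of_lt_of_le (by norm_num [klBetaMin]) hβ
  -- names
  set xg : GridPoint L (2 * (2 * M)) → TorusSite 2 L := fun p => p.2 with hxg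
  set τg : GridPoint L (2 * (2 * M)) → ℝ := fun p => gridTime β (2 * (2 * M)) p.1 with hτg
  set Xa : HubbardGrassmann L M := ExteriorAlgebra.map (Matrix.toLin' (gridSubMatrix L M β xg τg)) Wa with hXa
  set Xb : HubbardGrassmann L M := ExteriorAlgebra.map (Matrix.toLin' (gridSubMatrix L M β xg τg)) Wb with hXb
  set fa : TorusSite 2 L → ℝ := fun p => (∑ σ : Fin 2, ((selfEnergy L M β Xa (omega0 M, p) σ).re +
    (selfEnergy L M β Xa ((omega0 M).rev, p) σ).re)) / 4 with hfa
  set fb : TorusSite 2 L → ℝ := fun p => (∑ σ : Fin 2, ((selfEnergy L M β Xb (omega0 M, p) σ).re +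
    (selfEnergy L M β Xb ((omega0 M).rev, p) σ).re)) / 4 with hfb
  set G : Momentum → ℝ := evalM (symInterp L fa) with hG
  set H : Momentum → ℝ := evalM (symInterp L fb) with hH
  set γ : ℝ → Momentum := fun θ : ℝ => (WithLp.toLp 2 (klFermiPoint μ 0 θ) : Momentum) with hγdef
  -- the scale-0 symbol is `loc(map S W₀)` and `W₀ = W_a + W_b`
  have hrep : klLocSelfEnergyRe L M β U μ 0 0 = fa + fb := by
    have hmap : ExteriorAlgebra.map (Matrix.toLin' (gridSubMatrix L M β xg τg))
        (effAction ℂ ((hubbardGridSub L M β (2 * (2 * M))).transpose * hubbardCovAboveCT L M β μ 0 0 klE0 *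
          hubbardGridSub L M β (2 * (2 * M))) (hubbardGridInteraction L (2 * (2 * M)) β U)) = Xa + Xb := by
      rw [hsplit, map_add]
    have hW := klEffectiveAction_zero_frameZero_eq_map_gridSub (L := L) (M := M) hβ0.ne' U μ
    rw [hmap] at hW
    rw [← locSymbol_add β Xa Xb]
    funext p
    have h := klLocSelfEnergyRe_sub_frame_eq_locRe (L := L) (M := M) hβ0.ne' U μ 0 0 p
    rw [hW, TrigPolyC4v.eval_zero, sub_zero] at h
    exact h
  set F : Momentum → ℝ := evalM (symInterp L (klLocSelfEnergyRe L M β U μ 0 0)) with hF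
  have hFGH : F = G + H := by rw [hF, hrep, evalM_symInterp_add_fun]
  have hFc : ContDiff ℝ 4 F := contDiff_evalM _
  have hGc : ContDiff ℝ 4 G := contDiff_evalM _
  have hHc : ContDiff ℝ 4 H := contDiff_evalM _
  have hνF : klLocalPart L M β U μ 0 0 = F ∘ γ := by
    have h := klLocalPart_zero_sub_frame_eq_comp (L := L) (M := M) β U μ (0 : TrigPolyC4v)
    have hl : (fun θ => klLocalPart L M β U μ 0 0 θ - (0 : TrigPolyC4v).eval (klFermiPoint μ 0 θ)) = klLocalPart L M β U μ 0 0 := by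
      funext θ; simp
    rw [hl] at h
    rw [h]
    congr 1
    funext p
    simp [hF, evalM_apply]
  have hGγ : ContDiff ℝ 4 (G ∘ γ) := hGc.comp hγ
  have hHγ : ContDiff ℝ 4 (H ∘ γ) := hHc.comp hγ
  have hC : ContDiff ℝ 4 (fun θ : ℝ => klLocalPart L M β U μ 0 0 θ) := by
    rw [show (fun θ : ℝ => klLocalPart L M β U μ 0 0 θ) = klLocalPart L M β U μ 0 0 from rfl, hνF, hFGH]
    exact hGγ.add hHγ
  -- the moment part: momentum sizes of `G` from the pinned sums of `W_a`
  have hG0 : ∀ q : Momentum, ‖iteratedFDeriv ℝ 0 G q‖ ≤ 2 * (v * |U| + b 0 * U ^ 2) := by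
    intro q
    have hfull : ∀ (σ : Fin 2) (p₀ : GridPoint L (2 * (2 * M))), ∑ p₁ : GridPoint L (2 * (2 * M)),
        ‖kernel ℂ Wa 2 (fun i => ((![p₀, p₁] i, σ), i))‖ ≤ (v * |U| + b 0 * U ^ 2) * (β / ((2 * (2 * M) : ℕ) : ℝ)) := by
      intro σ p₀
      have hon := hBon σ p₀
      have hoff := hBoff 0 (Nat.zero_le _) σ p₀
      simp only [pow_zero] at hoff
      have hsum := add_le_add hon hoff
      rw [← sum_add_distrib] at hsum
      refine le_trans (le_of_eq (sum_congr rfl fun p₁ _ => ?_)) (hsum.trans (le_of_eq (by ring)))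
      by_cases hp : p₁.2 - p₀.2 = 0
      · rw [if_pos hp, if_pos hp]; ring
      · rw [if_neg hp, if_neg hp]; ring
    have h := gridSymbol_norm_le_of_pinned (L := L) (M := M) hβ0.ne' xg τg Wa hfull q
    rw [gridNorm_mul_eq (L := L) (M := M) hβ0] at h
    exact h
  have hGk : ∀ k, 1 ≤ k → k ≤ 4 → ∀ q : Momentum, ‖iteratedFDeriv ℝ k G q‖ ≤ 2 * b k * U ^ 2 := by
    intro k hk hk4 q
    have h := gridSymbol_jet_le_of_offSite (L := L) (M := M) hβ0.ne' xg τg Wa hk (fun σ p₀ => hBoff k hk4 σ p₀) q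
    rw [gridNorm_mul_eq (L := L) (M := M) hβ0] at h
    simpa only [mul_assoc] using h
  have hGτ : ∀ q : Momentum, |G q - torusCosCoeff L fa 0| ≤ 2 * b 0 * U ^ 2 := by
    intro q
    have h := gridSymbol_structuredValue_of_offSite (L := L) (M := M) hβ0.ne' xg τg Wa (B := b 0 * U ^ 2 * (β / ((2 * (2 * M) : ℕ) : ℝ)))
      (fun σ p₀ => by have h := hBoff 0 (Nat.zero_le _) σ p₀; simpa only [pow_zero] using h) q
    rw [gridNorm_mul_natural (L := L) (M := M) hβ0] at h
    exact h
  -- the two parts on the curve: additivity of the angular jets (orders `≤ 4`, where `γ₀ ∈ C⁴`)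
  have hval : ∀ θ, klLocalPart L M β U μ 0 0 θ = G (γ θ) + H (γ θ) := fun θ => by
    have h := congrFun hνF θ
    rw [hFGH] at h
    exact h
  have haddθ : ∀ k ≤ 4, ∀ θ, iteratedDeriv k (fun θ : ℝ => klLocalPart L M β U μ 0 0 θ) θ =
      iteratedDeriv k (G ∘ γ) θ + iteratedDeriv k (H ∘ γ) θ := by
    intro k hk4 θ
    rw [show (fun θ : ℝ => klLocalPart L M β U μ 0 0 θ) = klLocalPart L M β U μ 0 0 from rfl, hνF, hFGH]
    have hk' : ((k : ℕ) : WithTop ℕ∞) ≤ 4 := by exact_mod_cast hk4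
    show iteratedDeriv k ((G ∘ γ) + (H ∘ γ)) θ = _
    exact iteratedDeriv_add ((hGγ.of_le hk').contDiffAt) ((hHγ.of_le hk').contDiffAt)
  -- the curve part's data, in the local names
  have hHval' : ∀ θ, |H (γ θ)| ≤ hv * |U| + h0 * U ^ 2 := hHval
  have hHτ' : ∀ θ, |H (γ θ) - τ| ≤ s 0 * U ^ 2 := hHτ
  have hHjet' : ∀ k, 1 ≤ k → k ≤ 4 → ∀ θ, |iteratedDeriv k (H ∘ γ) θ| ≤ s k * U ^ 2 := hHjet
  have hjets : TwoLegReadJetBound L M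
      (fun k => if k = 0 then 2 * v + hv else if k = 1 then 2 * b 1 * D 1 + s 1 else if k = 2 then 2 * b 2 * D 1 ^ 2 + 2 * b 1 * D 2 + s 2
        else if k = 3 then 2 * b 3 * D 1 ^ 3 + 3 * (2 * b 2) * D 1 * D 2 + 2 * b 1 * D 3 + s 3
        else if k = 4 then 2 * b 4 * D 1 ^ 4 + 6 * (2 * b 3) * D 1 ^ 2 * D 2 + 3 * (2 * b 2) * D 2 ^ 2 + 4 * (2 * b 2) * D 1 * D 3 + 2 * b 1 * D 4 + s 4
        else 0)
      (fun k => if k = 0 then 2 * b 0 + h0 else 0) β U μ (klFlowFrameU L M β U μ 0) 0 := by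
    rw [klFlowFrameU_zero]
    refine ⟨hC, fun k hk4 θ => ?_⟩
    rcases Nat.eq_zero_or_pos k with rfl | hkpos
    · -- order 0: `|G| + |H| ≤ 2(v|U| + b₀U²) + hv|U| + h₀U²`
      rw [iteratedDeriv_zero, hval θ]
      have hGv : |G (γ θ)| ≤ 2 * (v * |U| + b 0 * U ^ 2) := by
        have h := hG0 (γ θ)
        rwa [norm_iteratedFDeriv_zero, Real.norm_eq_abs] at h
      refine (abs_add_le _ _).trans ((add_le_add hGv (hHval' θ)).trans (le_of_eq ?_))
      simp only [if_true, curveJetBar, uPow, Nat.cast_zero, zero_sub, mul_zero, zpow_zero, mul_one]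
      rw [show U ^ 2 = |U| * |U| by rw [← sq, sq_abs]]; ring
    · have hkne : k ≠ 0 := by omega
      obtain ⟨h1, h2, h3, h4⟩ := abs_iteratedDeriv_comp_le_bell hGc hγ (θ := θ) (M := fun k => 2 * b k * U ^ 2) (D := D)
        (fun l hl1 hl4 => hGk l hl1 hl4 _) (hD θ)
      rw [haddθ k hk4 θ]
      interval_cases k
      · refine (abs_add_le _ _).trans ((add_le_add h1 (hHjet' 1 le_rfl (by norm_num) θ)).trans (le_of_eq ?_))
        simp [curveJetBar, uPow]; ring
      · refine (abs_add_le _ _).trans ((add_le_add h2 (hHjet' 2 (by norm_num) (by norm_num) θ)).trans (le_of_eq ?_))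
        simp [curveJetBar, uPow]; ring
      · refine (abs_add_le _ _).trans ((add_le_add h3 (hHjet' 3 (by norm_num) (by norm_num) θ)).trans (le_of_eq ?_))
        simp [curveJetBar, uPow]; ring
      · refine (abs_add_le _ _).trans ((add_le_add h4 (hHjet' 4 (by norm_num) le_rfl θ)).trans (le_of_eq ?_))
        simp [curveJetBar, uPow]; ring
  refine ⟨hjets, ?_⟩
  -- the mean-free clause from the two structured values (on-site part of `W_a` and the constant `τ` of `W_b` drop exactly)
  have hA : ∀ θ : ℝ, |klTwoLegCurveProfile L M β U μ 0 0 θ - (torusCosCoeff L fa 0 + τ)| ≤ (2 * b 0 + s 0) * U ^ 2 := by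
    intro θ
    rw [← C4a.klLocalPart_zero_frame_eq_profile β U μ θ, hval θ]
    calc |G (γ θ) + H (γ θ) - (torusCosCoeff L fa 0 + τ)| = |(G (γ θ) - torusCosCoeff L fa 0) + (H (γ θ) - τ)| := by ring_nf
      _ ≤ |G (γ θ) - torusCosCoeff L fa 0| + |H (γ θ) - τ| := abs_add_le _ _
      _ ≤ 2 * b 0 * U ^ 2 + s 0 * U ^ 2 := add_le_add (hGτ (γ θ)) (hHτ' θ)
      _ = (2 * b 0 + s 0) * U ^ 2 := by ring
  exact twoLegReadOscAt_zero_of_structured hC.continuous hA (by linarith)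

/-! ## §4 The REGISTERED n = 0 conclusion of stub (C) from the split, five fits -/

/-- **(C) AT `n = 0`, REGISTERED TABLES, from a split grid element + five numeric fits**: with the mixed private tables `cMix, cMix′` of
`twoLegRead_frameZero_of_split_certD`, the fits `cMix k ≤ klC4aJetC2 k` (`k ≤ 4`), `2b₀ + h₀ ≤ klC4aJetC′ P R 0`, `4b₀ + 2s₀ ≤ klReadOscC P R` give
`TwoLegReadJetBound L M klC4aJetC2 (klC4aJetC′ P R) β U μ (K₀) 0 ∧ TwoLegReadOscAt L M (klReadOscC P R) β U μ (K₀) 0` — the registered n = 0 pair;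
for a re-tabled n = 0 slot («(C0)») use the private form and `TwoLegReadJetBound.mono` with the new tables. -/
theorem twoLegRead_frameZero_registered_of_split_certD (P : SplitConsts) (R : RenConsts) (hβ : klBetaMin ≤ β) {v hv h0 τ : ℝ}
    {b D s : ℕ → ℝ} (Wa Wb : GrassmannAlgebra ℂ (GridLeg (GridPoint L (2 * (2 * M)))))
    (hsplit : effAction ℂ ((hubbardGridSub L M β (2 * (2 * M))).transpose * hubbardCovAboveCT L M β μ 0 0 klE0 *
        hubbardGridSub L M β (2 * (2 * M))) (hubbardGridInteraction L (2 * (2 * M)) β U) = Wa + Wb)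
    (hBon : ∀ (σ : Fin 2) (p₀ : GridPoint L (2 * (2 * M))), ∑ p₁ : GridPoint L (2 * (2 * M)),
      (if p₁.2 - p₀.2 = 0 then (1 : ℝ) else 0) * ‖kernel ℂ Wa 2 (fun i => ((![p₀, p₁] i, σ), i))‖ ≤ v * |U| * (β / ((2 * (2 * M) : ℕ) : ℝ)))
    (hBoff : ∀ k ≤ 4, ∀ (σ : Fin 2) (p₀ : GridPoint L (2 * (2 * M))), ∑ p₁ : GridPoint L (2 * (2 * M)),
      (if p₁.2 - p₀.2 = 0 then (0 : ℝ) else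
        (1 + (((p₁.2 - p₀.2) 0).valMinAbs.natAbs : ℝ) + (((p₁.2 - p₀.2) 1).valMinAbs.natAbs : ℝ)) ^ k) *
        ‖kernel ℂ Wa 2 (fun i => ((![p₀, p₁] i, σ), i))‖ ≤ b k * U ^ 2 * (β / ((2 * (2 * M) : ℕ) : ℝ)))
    (hγ : ContDiff ℝ 4 fun θ : ℝ => (WithLp.toLp 2 (klFermiPoint μ 0 θ) : Momentum))
    (hD : ∀ θ : ℝ, ∀ i, 1 ≤ i → i ≤ 4 → ‖iteratedDeriv i (fun θ : ℝ => (WithLp.toLp 2 (klFermiPoint μ 0 θ) : Momentum)) θ‖ ≤ D i)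
    (hHval : ∀ θ : ℝ, |evalM (symInterp L (fun p : TorusSite 2 L =>
        (∑ σ : Fin 2, ((selfEnergy L M β (ExteriorAlgebra.map (Matrix.toLin' (gridSubMatrix L M β
            (fun p : GridPoint L (2 * (2 * M)) => p.2) (fun p => gridTime β (2 * (2 * M)) p.1))) Wb) (omega0 M, p) σ).re +
          (selfEnergy L M β (ExteriorAlgebra.map (Matrix.toLin' (gridSubMatrix L M β
            (fun p : GridPoint L (2 * (2 * M)) => p.2) (fun p => gridTime β (2 * (2 * M)) p.1))) Wb) ((omega0 M).rev, p) σ).re)) / 4))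
        (WithLp.toLp 2 (klFermiPoint μ 0 θ))| ≤ hv * |U| + h0 * U ^ 2)
    (hHτ : ∀ θ : ℝ, |evalM (symInterp L (fun p : TorusSite 2 L =>
        (∑ σ : Fin 2, ((selfEnergy L M β (ExteriorAlgebra.map (Matrix.toLin' (gridSubMatrix L M β
            (fun p : GridPoint L (2 * (2 * M)) => p.2) (fun p => gridTime β (2 * (2 * M)) p.1))) Wb) (omega0 M, p) σ).re +
          (selfEnergy L M β (ExteriorAlgebra.map (Matrix.toLin' (gridSubMatrix L M β
            (fun p : GridPoint L (2 * (2 * M)) => p.2) (fun p => gridTime β (2 * (2 * M)) p.1))) Wb) ((omega0 M).rev, p) σ).re)) / 4))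
        (WithLp.toLp 2 (klFermiPoint μ 0 θ)) - τ| ≤ s 0 * U ^ 2)
    (hHjet : ∀ k, 1 ≤ k → k ≤ 4 → ∀ θ : ℝ, |iteratedDeriv k (fun θ : ℝ => evalM (symInterp L (fun p : TorusSite 2 L =>
        (∑ σ : Fin 2, ((selfEnergy L M β (ExteriorAlgebra.map (Matrix.toLin' (gridSubMatrix L M β
            (fun p : GridPoint L (2 * (2 * M)) => p.2) (fun p => gridTime β (2 * (2 * M)) p.1))) Wb) (omega0 M, p) σ).re +
          (selfEnergy L M β (ExteriorAlgebra.map (Matrix.toLin' (gridSubMatrix L M β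
            (fun p : GridPoint L (2 * (2 * M)) => p.2) (fun p => gridTime β (2 * (2 * M)) p.1))) Wb) ((omega0 M).rev, p) σ).re)) / 4))
        (WithLp.toLp 2 (klFermiPoint μ 0 θ))) θ| ≤ s k * U ^ 2)
    -- the five fits against the registered tables
    (hfit0 : 2 * v + hv ≤ klC4aJetC2 0) (hfit1 : 2 * b 1 * D 1 + s 1 ≤ klC4aJetC2 1)
    (hfit2 : 2 * b 2 * D 1 ^ 2 + 2 * b 1 * D 2 + s 2 ≤ klC4aJetC2 2)
    (hfit3 : 2 * b 3 * D 1 ^ 3 + 3 * (2 * b 2) * D 1 * D 2 + 2 * b 1 * D 3 + s 3 ≤ klC4aJetC2 3)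
    (hfit4 : 2 * b 4 * D 1 ^ 4 + 6 * (2 * b 3) * D 1 ^ 2 * D 2 + 3 * (2 * b 2) * D 2 ^ 2 + 4 * (2 * b 2) * D 1 * D 3 + 2 * b 1 * D 4 + s 4 ≤ klC4aJetC2 4)
    (hfit0' : 2 * b 0 + h0 ≤ klC4aJetC' P R 0) (hfitO : 4 * b 0 + 2 * s 0 ≤ klReadOscC P R) :
    TwoLegReadJetBound L M klC4aJetC2 (klC4aJetC' P R) β U μ (klFlowFrameU L M β U μ 0) 0 ∧
      TwoLegReadOscAt L M (klReadOscC P R) β U μ (klFlowFrameU L M β U μ 0) 0 := by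
  obtain ⟨hJ, hO⟩ := twoLegRead_frameZero_of_split_certD (L := L) (M := M) hβ Wa Wb hsplit hBon hBoff hγ hD hHval hHτ hHjet
  refine ⟨hJ.mono (fun k => ?_) (fun k => ?_), hO.mono hfitO⟩
  · rcases Nat.eq_zero_or_pos k with rfl | hkpos
    · simpa only [if_true] using hfit0
    · have hkne : k ≠ 0 := by omega
      by_cases hk4 : k ≤ 4
      · interval_cases k
        · simpa using hfit1
        · simpa using hfit2
        · simpa using hfit3
        · simpa using hfit4
      · rw [if_neg hkne, if_neg (by omega), if_neg (by omega), if_neg (by omega), if_neg (by omega)]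
        exact klC4aJetC2_nonneg k
  · rcases Nat.eq_zero_or_pos k with rfl | hkpos
    · simpa only [if_true] using hfit0'
    · have hkne : k ≠ 0 := by omega
      rw [if_neg hkne]; exact klC4aJetC'_nonneg P R k

end Door

end Summit.HubbardSuperconductivity.HubbardSuperconductivity.Theorems.KLRegimeSplit

end
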